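import Summits.QuantumFields.YangMills.Theorems.UnitScaleTiltProp7TorusGreenGradientDecay
import HarnessLib

/-!
# Decay of the gradient of the torus Green function in four dimensions (helper of the YM cold-box kernel stubs)

Route `AllWindowsColdBox` (LINE-19 S3 / LINE-20 U1, crux ⟨stmt-QuantumFields-24336⟩, parent ⟨24004⟩; planner ym-idea-2 g17 STUB-PLAN-U1 rev 2 §6:
image method for the box Green functions).  Companion of the tree's `Literature/…/TorusGreenHessianDecay.lean` (chain `SRWHeatKernel1D` →
`TorusHeatKernel1D` → `TorusGreenHeatKernel`): for the zero-mode-removed Green function `G̃_L = torusGreen` of `(ℤ/Lℤ)⁴`,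
**`torusGreen_grad_mul_dist_pow_three_le`: `|G̃_L(z + eᵢ) − G̃_L(z)| · dist(0,z)³ ≤ C` uniformly in `L`** (`dist² = Σ_μ z̃_μ²`,
`z̃ = valMinAbs`), the lattice finite-volume counterpart of `∂ᵢ|x|⁻² = O(|x|⁻³)`; it feeds the 16-image formula for Dirichlet/Neumann
box Green functions (gradient bounds up to the wall).  Proof as for the Hessian: `∇ᵢG̃ = ∫₀^{L²} ∇ᵢ[∏_μ q^L_s] ds + tail`
(tree `Prop7TorusGreenGradientDecay.torusGreen_grad_eq`, d = 3 there; general `d`); the gradient of the product kernel is one difference times three plain factors,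
`≤ K⁴ √(1∨s) ((1∨s) + M²)⁻³ ≤ K⁴ (2M)⁻¹ (s + M²)⁻²` (`abs_grad_prod_torusHeatKernel_le_four`, AM–GM), time integral `≤ K⁴/(2M³)` (tree `integral_inv_add_sq_le`); the tail is
`≤ (π/4) C₀⁴ L⁻³` (tree `abs_torusGreen_grad_tail_le`, general `d`); `dist ≤ 2M ≤ L`.  The tree's `…Prop7TorusGreenGradientDecay`
proves the `d = 3` decay `dist²`; this file is its `d = 4` twin, reusing the dimension-free bricks.
Reference: Lawler–Limic 2010, Thm. 4.3.1, §6.3 [LawlerLimic2010].  Everything proved; no definitions; standard axioms.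
HONEST LABEL: a general lattice-analysis helper (our statement and proof, filed under Summits/ per the Literature lint); no stub, crux, rung or
summit is proved; the Yang–Mills mass gap is NOT proved by this file.
-/

set_option autoImplicit false

noncomputable section

open MeasureTheory Set Filter Finset ZMod intervalIntegral
open scoped Real Topology BigOperators ComplexConjugate

namespace Summit.QuantumFields.YangMills.Theorems.AllWindowsColdBox.TorusGreenGradient

open Literature.Probability.LatticeModels
open Summit.QuantumFields.YangMills.Theorems.Prop7TorusGreenGradientBricks (grad_prod integral_inv_add_sq_le prod_le_apply_of_le_one')
open Summit.QuantumFields.YangMills.Theorems.Prop7TorusGreenGradientDecay (torusGreen_grad_eq abs_torusGreen_grad_tail_le)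

variable {d L : ℕ} [NeZero L]

/-- **Bound on the gradient of the product heat kernel of `(ℤ/Lℤ)⁴`**: there is `K > 0` such that for all `L ≥ 1`,
`0 < s ≤ L²`, `z ∈ (ℤ/Lℤ)⁴`, all `i` and every coordinate `μ₀`,
`|∇ᵢ[∏_μ q^L_s(·_μ)](z)| ≤ K √(1∨s) ((1∨s) + z̃_{μ₀}²)⁻³`: three plain factors `(1∨s)^{-1/2}` each, one difference
`(1∨s)^{-1}`, and the Gaussian weight at `μ₀`. [folklore] -/
theorem abs_grad_prod_torusHeatKernel_le_four : ∃ K : ℝ, 0 < K ∧ ∀ (L : ℕ) [NeZero L] (s : ℝ),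
    0 < s → s ≤ (L : ℝ) ^ 2 → ∀ (z : TorusSite 4 L) (i μ₀ : Fin 4),
      |(∏ μ, torusHeatKernel s ((z + Pi.single i 1 : TorusSite 4 L) μ)) - ∏ μ, torusHeatKernel s (z μ)| ≤
        K * Real.sqrt (max 1 s) * ((max 1 s + ((z μ₀).valMinAbs : ℝ) ^ 2) ^ 3)⁻¹ := by
  obtain ⟨K₀, hK₀, h₀⟩ := abs_torusHeatKernel_le
  obtain ⟨K₁, hK₁, h₁⟩ := abs_torusHeatKernel_fwdDiff_le
  set K : ℝ := max K₀ K₁ with hK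
  have hK0 : K₀ ≤ K := le_max_left _ _
  have hK1 : K₁ ≤ K := le_max_right _ _
  have hKpos : 0 < K := hK₀.trans_le hK0
  refine ⟨K ^ 4, by positivity, ?_⟩
  intro L _ s hs hsL z i μ₀
  set T : ℝ := max 1 s with hT
  have hT1 : 1 ≤ T := le_max_left _ _
  have hT0 : 0 < T := by positivity
  set σ : ℝ := T ^ (-(1 / 2 : ℝ)) with hσ
  have hσ0 : 0 < σ := Real.rpow_pos_of_pos hT0 _
  have hσσ : σ * σ = T⁻¹ := max_one_rpow_neg_half_mul_self s
  -- `σ T = √T`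
  have hσT : σ * T = Real.sqrt T := by
    have h2 : (σ * T) ^ 2 = T := by
      calc (σ * T) ^ 2 = (σ * σ) * T * T := by ring
        _ = T := by rw [hσσ, inv_mul_cancel₀ hT0.ne', one_mul]
    rw [← Real.sqrt_sq (by positivity : 0 ≤ σ * T), h2]
  -- the Gaussian weights
  set W : Fin 4 → ℝ := fun μ => ((1 + ((z μ).valMinAbs : ℝ) ^ 2 / T) ^ 3)⁻¹ with hW
  have hW0 : ∀ μ, 0 ≤ W μ := fun μ => by positivity
  have hW1 : ∀ μ, W μ ≤ 1 := fun μ => by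
    have : 0 ≤ ((z μ).valMinAbs : ℝ) ^ 2 / T := by positivity
    exact inv_le_one_of_one_le₀ (one_le_pow₀ (by linarith))
  have hWμ₀ : ∏ μ, W μ ≤ W μ₀ := prod_le_apply_of_le_one' hW0 hW1 μ₀
  have b₀ : ∀ m : ZMod L, |torusHeatKernel s m| ≤ K * σ * ((1 + (m.valMinAbs : ℝ) ^ 2 / T) ^ 3)⁻¹ := fun m =>
    (h₀ L s hs hsL m).trans (by gcongr)
  have b₁ : ∀ m : ZMod L, |torusHeatKernel s (m + 1) - torusHeatKernel s m| ≤
      K * T⁻¹ * ((1 + (m.valMinAbs : ℝ) ^ 2 / T) ^ 3)⁻¹ := fun m =>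
    (h₁ L s hs hsL m).trans (by gcongr)
  -- the target weight: `K⁴ T⁻¹ σ³ W μ₀ = K⁴ √T ((T + m²)³)⁻¹`
  have htarget : K ^ 4 * (T⁻¹ * (σ * (σ * σ))) * W μ₀ =
      K ^ 4 * Real.sqrt T * ((T + ((z μ₀).valMinAbs : ℝ) ^ 2) ^ 3)⁻¹ := by
    rw [hW, hσσ, ← hσT]
    simp only
    have hTne : T ≠ 0 := hT0.ne'
    field_simp
  rw [← htarget, grad_prod (fun m => torusHeatKernel s m) z i, abs_mul, Finset.abs_prod]
  have hcard : ((univ : Finset (Fin 4)).erase i).card = 3 := by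
    rw [Finset.card_erase_of_mem (Finset.mem_univ i), Finset.card_univ, Fintype.card_fin]
  have hrest : ∏ μ ∈ (univ : Finset (Fin 4)).erase i, |torusHeatKernel s (z μ)| ≤
      ∏ μ ∈ (univ : Finset (Fin 4)).erase i, (K * σ * W μ) :=
    Finset.prod_le_prod (fun μ _ => abs_nonneg _) fun μ _ => b₀ (z μ)
  calc |torusHeatKernel s (z i + 1) - torusHeatKernel s (z i)| * ∏ μ ∈ (univ : Finset (Fin 4)).erase i, |torusHeatKernel s (z μ)|
      ≤ (K * T⁻¹ * W i) * ∏ μ ∈ (univ : Finset (Fin 4)).erase i, (K * σ * W μ) :=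
        mul_le_mul (b₁ (z i)) hrest (Finset.prod_nonneg fun μ _ => abs_nonneg _) (by positivity)
    _ = K ^ 4 * (T⁻¹ * (σ * (σ * σ))) * (W i * ∏ μ ∈ (univ : Finset (Fin 4)).erase i, W μ) := by
        rw [Finset.prod_mul_distrib, Finset.prod_const, hcard]
        ring
    _ = K ^ 4 * (T⁻¹ * (σ * (σ * σ))) * ∏ μ, W μ := by
        rw [Finset.mul_prod_erase _ _ (Finset.mem_univ i)]
    _ ≤ K ^ 4 * (T⁻¹ * (σ * (σ * σ))) * W μ₀ := by gcongr

/-- **Decay of the gradient of the torus Green function in `d = 4`, uniformly in the period.**  There is an absolute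
constant `C` such that for every `L ≥ 1`, all `i ∈ {0,1,2,3}` and every `z ≠ 0` in `(ℤ/Lℤ)⁴`,
`|G̃_L(z + eᵢ) − G̃_L(z)| · (∑_μ z̃_μ²)^{3/2} ≤ C`, `G̃_L = torusGreen`, `z̃_μ = valMinAbs (z μ)`. [folklore] -/
theorem torusGreen_grad_mul_dist_pow_three_le : ∃ C : ℝ, ∀ (L : ℕ) [NeZero L] (i : Fin 4)
    (z : TorusSite 4 L), z ≠ 0 →
      |torusGreen (z + Pi.single i 1) - torusGreen z| * Real.sqrt (∑ k, (((z k).valMinAbs : ℤ) : ℝ) ^ 2) ^ 3 ≤ C := by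
  obtain ⟨K, hK, hP⟩ := abs_grad_prod_torusHeatKernel_le_four
  set C₀ : ℝ := ∑' n : ℤ, (1 / 2 : ℝ) ^ n.natAbs with hC₀
  refine ⟨4 * K + π / 4 * C₀ ^ 4, ?_⟩
  intro L _ i z hz
  have hL : (0 : ℝ) < L := by exact_mod_cast Nat.pos_of_ne_zero (NeZero.ne L)
  -- the largest centred coordinate
  obtain ⟨μ₀, -, hμ₀⟩ := Finset.exists_max_image (univ : Finset (Fin 4))
    (fun μ => (z μ).valMinAbs.natAbs) Finset.univ_nonempty
  set M : ℝ := |((z μ₀).valMinAbs : ℝ)| with hM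
  have hMμ : ∀ μ, |((z μ).valMinAbs : ℝ)| ≤ M := fun μ => by
    have h := hμ₀ μ (Finset.mem_univ μ)
    rw [hM, ← Int.cast_abs, ← Int.cast_abs, ← Int.natCast_natAbs, ← Int.natCast_natAbs]
    exact_mod_cast h
  have hM1 : 1 ≤ M := by
    obtain ⟨μ₁, hμ₁⟩ : ∃ μ, z μ ≠ 0 := by
      by_contra h; push Not at h; exact hz (funext h)
    have h1 : (z μ₁).valMinAbs ≠ 0 := fun h => hμ₁ ((ZMod.valMinAbs_eq_zero _).1 h)
    have h2 : (1 : ℝ) ≤ |((z μ₁).valMinAbs : ℝ)| := by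
      rw [← Int.cast_abs]
      exact_mod_cast Int.one_le_abs h1
    exact h2.trans (hMμ μ₁)
  have hM0 : 0 < M := by linarith
  have hML : 2 * M ≤ L := by
    have h := two_mul_abs_valMinAbs_le (z μ₀)
    rw [hM, ← Int.cast_abs]
    exact_mod_cast h
  -- the distance
  have hdist : Real.sqrt (∑ k, (((z k).valMinAbs : ℤ) : ℝ) ^ 2) ^ 3 ≤ 8 * M ^ 3 := by
    have hsum : ∑ k, (((z k).valMinAbs : ℤ) : ℝ) ^ 2 ≤ 4 * M ^ 2 := by
      calc ∑ k, (((z k).valMinAbs : ℤ) : ℝ) ^ 2 ≤ ∑ _k : Fin 4, M ^ 2 :=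
            Finset.sum_le_sum fun k _ => by
              rw [← sq_abs]
              exact pow_le_pow_left₀ (abs_nonneg _) (hMμ k) 2
        _ = 4 * M ^ 2 := by simp
    have h0 : 0 ≤ ∑ k, (((z k).valMinAbs : ℤ) : ℝ) ^ 2 := Finset.sum_nonneg fun k _ => sq_nonneg _
    have hsq : Real.sqrt (∑ k, (((z k).valMinAbs : ℤ) : ℝ) ^ 2) ≤ 2 * M := by
      rw [← Real.sqrt_sq (by positivity : (0 : ℝ) ≤ 2 * M)]
      exact Real.sqrt_le_sqrt (by nlinarith)
    calc Real.sqrt (∑ k, (((z k).valMinAbs : ℤ) : ℝ) ^ 2) ^ 3 ≤ (2 * M) ^ 3 :=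
          pow_le_pow_left₀ (Real.sqrt_nonneg _) hsq 3
      _ = 8 * M ^ 3 := by ring
  -- the gradient: heat-kernel part and tail at `S = L²`
  have hS : (0 : ℝ) ≤ (L : ℝ) ^ 2 := by positivity
  rw [torusGreen_grad_eq z i ((L : ℝ) ^ 2)]
  have hmain : |∫ s in (0 : ℝ)..(L : ℝ) ^ 2,
      ((∏ μ, torusHeatKernel s ((z + Pi.single i 1 : TorusSite 4 L) μ)) - ∏ μ, torusHeatKernel s (z μ))| ≤
      K * (2 * M)⁻¹ * (M ^ 2)⁻¹ := by
    -- pointwise: K √T ((T+M²)³)⁻¹ ≤ K (2M)⁻¹ ((s+M²)²)⁻¹ by AM–GM `2M√T ≤ T + M²` and `T ≥ s`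
    have hb : ∀ s ∈ Set.Ioc (0 : ℝ) ((L : ℝ) ^ 2),
        |(∏ μ, torusHeatKernel s ((z + Pi.single i 1 : TorusSite 4 L) μ)) - ∏ μ, torusHeatKernel s (z μ)| ≤
        K * (2 * M)⁻¹ * ((s + M ^ 2) ^ 2)⁻¹ := by
      intro s hs
      refine (hP L s hs.1 hs.2 z i μ₀).trans ?_
      rw [hM, sq_abs]
      set T := max 1 s with hT
      set m : ℝ := ((z μ₀).valMinAbs : ℝ) with hm
      have hT0 : 0 < T := lt_of_lt_of_le one_pos (le_max_left _ _)
      have hsT : s ≤ T := le_max_right _ _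
      have hmM : |m| = M := by rw [hM]
      have hm1 : 1 ≤ |m| := by rw [hmM]; exact hM1
      have hm0 : 0 < |m| := by linarith
      have hTm : 0 < T + m ^ 2 := by positivity
      -- AM–GM: 2|m|√T ≤ T + m²
      have hamgm : 2 * |m| * Real.sqrt T ≤ T + m ^ 2 := by
        have h1 : Real.sqrt T ^ 2 = T := Real.sq_sqrt hT0.le
        nlinarith [sq_nonneg (Real.sqrt T - |m|), sq_abs m, Real.sqrt_nonneg T]
      have hsm : (s + m ^ 2) ^ 2 ≤ (T + m ^ 2) ^ 2 := by
        have : 0 < s + m ^ 2 := by have := hs.1; positivity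
        gcongr
      rw [show |((z μ₀).valMinAbs : ℝ)| = |m| from rfl]
      calc K * Real.sqrt T * ((T + m ^ 2) ^ 3)⁻¹
          = K * (Real.sqrt T / (T + m ^ 2)) * ((T + m ^ 2) ^ 2)⁻¹ := by field_simp
        _ ≤ K * ((2 * |m|)⁻¹) * ((s + m ^ 2) ^ 2)⁻¹ := by
            have h1 : Real.sqrt T / (T + m ^ 2) ≤ (2 * |m|)⁻¹ := by
              rw [div_le_iff₀ hTm]
              have h3 : Real.sqrt T ≤ (T + m ^ 2) / (2 * |m|) := by
                rw [le_div_iff₀ (by positivity)]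
                linarith
              calc Real.sqrt T ≤ (T + m ^ 2) / (2 * |m|) := h3
                _ = (2 * |m|)⁻¹ * (T + m ^ 2) := by rw [div_eq_inv_mul]
            have h2 : ((T + m ^ 2) ^ 2)⁻¹ ≤ ((s + m ^ 2) ^ 2)⁻¹ :=
              inv_anti₀ (by have := hs.1; positivity) hsm
            gcongr
    have hcont : IntervalIntegrable (fun s : ℝ => K * (2 * M)⁻¹ * ((s + M ^ 2) ^ 2)⁻¹) volume 0 ((L : ℝ) ^ 2) := by
      refine ContinuousOn.intervalIntegrable ?_
      rw [Set.uIcc_of_le hS]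
      refine continuousOn_const.mul (ContinuousOn.inv₀
        ((continuousOn_id.add continuousOn_const).pow 2) fun s hs => ?_)
      have : 0 < s + M ^ 2 := by have := hs.1; positivity
      positivity
    calc _ ≤ ∫ s in (0 : ℝ)..(L : ℝ) ^ 2, K * (2 * M)⁻¹ * ((s + M ^ 2) ^ 2)⁻¹ := by
          have h := intervalIntegral.norm_integral_le_of_norm_le hS
            (Filter.Eventually.of_forall fun s hs => (Real.norm_eq_abs _).le.trans (hb s hs)) hcont
          rwa [Real.norm_eq_abs] at h
      _ = K * (2 * M)⁻¹ * ∫ s in (0 : ℝ)..(L : ℝ) ^ 2, ((s + M ^ 2) ^ 2)⁻¹ :=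
          intervalIntegral.integral_const_mul _ _
      _ ≤ K * (2 * M)⁻¹ * (M ^ 2)⁻¹ := by
          gcongr
          exact integral_inv_add_sq_le (by positivity) hS
  have htail := abs_torusGreen_grad_tail_le z i
  rw [← hC₀] at htail
  -- `π/4 · L · C₀⁴ / L⁴ = (π/4) C₀⁴ / L³ ≤ (π/4) C₀⁴ / (8 M³)`
  have hL3 : π / 4 * C₀ ^ 4 * L / (L : ℝ) ^ 4 ≤ π / 4 * C₀ ^ 4 * (8 * M ^ 3)⁻¹ := by
    have hC0 : 0 ≤ C₀ := tsum_nonneg fun n => by positivity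
    have h8 : 8 * M ^ 3 ≤ (L : ℝ) ^ 3 := by
      have : (2 * M) ^ 3 ≤ (L : ℝ) ^ 3 := pow_le_pow_left₀ (by positivity) hML 3
      nlinarith
    rw [show π / 4 * C₀ ^ 4 * L / (L : ℝ) ^ 4 = π / 4 * C₀ ^ 4 * ((L : ℝ) ^ 3)⁻¹ by
      field_simp]
    gcongr
  calc _ ≤ (K * (2 * M)⁻¹ * (M ^ 2)⁻¹ + π / 4 * C₀ ^ 4 * L / (L : ℝ) ^ 4) * (8 * M ^ 3) :=
        mul_le_mul ((abs_add_le _ _).trans (add_le_add hmain htail)) hdist (by positivity) (by positivity)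
    _ ≤ (K * (2 * M)⁻¹ * (M ^ 2)⁻¹ + π / 4 * C₀ ^ 4 * (8 * M ^ 3)⁻¹) * (8 * M ^ 3) := by gcongr
    _ = 4 * K + π / 4 * C₀ ^ 4 := by
        field_simp
        ring

end Summit.QuantumFields.YangMills.Theorems.AllWindowsColdBox.TorusGreenGradient
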